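import Mathlib
import Literature.NumberTheory.Sieve.Maynard2016KernelPolylog
import Literature.NumberTheory.Sieve.Maynard2016CoupledLocalW
import Literature.NumberTheory.Sieve.Maynard2016CoupledKernelWLimit
import HarnessLib

/-!
# Maynard (2016), Lemma 7: the weighted coupled kernel is polylogarithmic

Topic `Literature/NumberTheory/Sieve`; trunk AntSieve / parity (Maynard 2016 large-gaps ladder, named
fact `Literature.NumberTheory.Sieve.Maynard2016.Lemma7Tuple` of `Maynard2016Lemma7PerTuple.lean`).

J. Maynard, *Large gaps between primes*, Ann. of Math. (2) 183 (2016), 915–933 = arXiv:1408.5110,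
§6 display (6.11) ("`∏_p K_p ≪ (log x)^{O_k(1)}`") and Lemma 7 (6.32).  Port of the `LcmEuler` half
of `Maynard2016KernelPolylog` to the weighted kernel `coupledKernelW w` (`IsLcmWeight w`, e.g. `1/φ`):
`|K^w_p − 1| ≤ 2C p^{−1−σ}` (`C = crudeExp k₁ k₂ = 3k₁ + 3k₂ + 9k₁k₂`), hence
`‖∏_{p ∈ P} K^w_p‖ ≤ ζ(1+σ)^{2C}` and **`‖K^w‖ ≤ ζ(1+σ)^{2C}`** (`norm_coupledKernelW_le_zetaR_pow`).

## References

* J. Maynard, *Large gaps between primes*, Ann. of Math. (2) 183 (2016), 915–933; arXiv:1408.5110,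
  §6, (6.11) and (6.32). [Maynard2016LargeGaps]
-/

noncomputable section

open Filter Finset
open scoped BigOperators Topology ArithmeticFunction.Moebius Classical

namespace Literature.NumberTheory.Sieve

namespace LcmEuler

variable {ι κ : Type*} [Fintype ι] [Fintype κ]

/-- `|X_p| ≤ C p^{−1−σ} · p` for the Möbius slot sum (from `|K_p − 1| ≤ C p^{−1−σ}` and
`X_p = p (K_p − 1)`). [cite: Maynard2016LargeGaps, §6 display (6.11)] -/
theorem norm_slotSum_moebiusWeight_le_rpow (m : ℕ) (M : ℕ → Finset (ι × κ)) {a b : ι → ℂ}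
    {a' b' : κ → ℂ} {σ : ℝ} (hσ : 0 ≤ σ) (hab : ∀ i, σ ≤ (a i).re ∧ σ ≤ (b i).re)
    (hab' : ∀ j, σ ≤ (a' j).re ∧ σ ≤ (b' j).re) {q : ℕ} (hq : q.Prime) :
    ‖slotSum (moebiusWeight a) (moebiusWeight b) (moebiusWeight a') (moebiusWeight b') m M q‖ ≤
      (crudeExp (Fintype.card ι) (Fintype.card κ) : ℝ) * (q : ℝ) ^ (-(1 + σ)) * q := by
  classical
  have hqr : (0 : ℝ) < q := by exact_mod_cast hq.pos
  have hqc : (q : ℂ) ≠ 0 := by exact_mod_cast hq.ne_zero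
  have hK := norm_coupledLocalFactorMu_sub_one_le m M hσ hab hab' hq
  have hS : slotSum (moebiusWeight a) (moebiusWeight b) (moebiusWeight a') (moebiusWeight b') m M q =
      (coupledLocalFactorMu m M a b a' b' q - 1) * q := by
    rw [coupledLocalFactorMu, coupledLocalFactor_eq_one_add, add_sub_cancel_left, div_mul_cancel₀ _ hqc]
  rw [hS, norm_mul, Complex.norm_natCast]
  exact mul_le_mul_of_nonneg_right hK hqr.le

/-- **`K^w_p = 1 + O_k(p^{−1−σ})`**: `|K^w_p − 1| ≤ 2(3k₁ + 3k₂ + 9k₁k₂) p^{−1−σ}` for a prime `p`, an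
`IsLcmWeight w` and exponents of real part `≥ σ ≥ 0`. [cite: Maynard2016LargeGaps, §6 displays (6.11), (6.32)] -/
theorem norm_coupledLocalFactorMuW_sub_one_le {w : ℕ → ℂ} (hw : IsLcmWeight w) (m : ℕ)
    (M : ℕ → Finset (ι × κ)) {a b : ι → ℂ} {a' b' : κ → ℂ} {σ : ℝ} (hσ : 0 ≤ σ)
    (hab : ∀ i, σ ≤ (a i).re ∧ σ ≤ (b i).re) (hab' : ∀ j, σ ≤ (a' j).re ∧ σ ≤ (b' j).re) {q : ℕ}
    (hq : q.Prime) :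
    ‖coupledLocalFactorMuW w m M a b a' b' q - 1‖ ≤
      2 * (crudeExp (Fintype.card ι) (Fintype.card κ) : ℝ) * (q : ℝ) ^ (-(1 + σ)) := by
  classical
  have hqr : (0 : ℝ) < q := by exact_mod_cast hq.pos
  have hS := norm_slotSum_moebiusWeight_le_rpow m M hσ hab hab' hq
  have hp0 : 0 ≤ (q : ℝ) ^ (-(1 + σ)) := Real.rpow_nonneg hqr.le _
  rw [coupledLocalFactorMuW, coupledLocalFactorW_eq_one_add, add_sub_cancel_left, norm_mul]
  calc ‖w q‖ * ‖slotSum (moebiusWeight a) (moebiusWeight b) (moebiusWeight a') (moebiusWeight b') m M q‖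
      ≤ 2 / q * ((crudeExp (Fintype.card ι) (Fintype.card κ) : ℝ) * (q : ℝ) ^ (-(1 + σ)) * q) :=
        mul_le_mul (hw.norm_le q hq) hS (norm_nonneg _) (by positivity)
    _ = 2 * (crudeExp (Fintype.card ι) (Fintype.card κ) : ℝ) * (q : ℝ) ^ (-(1 + σ)) := by
        field_simp

/-- `‖∏_{p ∈ P} K^w_p‖ ≤ ζ(1+σ)^{2C}` for a finite set of primes `P` (`σ > 0`).
[cite: Maynard2016LargeGaps, §6 displays (6.11), (6.32)] -/
theorem norm_prod_coupledLocalFactorMuW_le {w : ℕ → ℂ} (hw : IsLcmWeight w) (m : ℕ)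
    (M : ℕ → Finset (ι × κ)) {a b : ι → ℂ} {a' b' : κ → ℂ} {σ : ℝ} (hσ : 0 < σ)
    (hab : ∀ i, σ ≤ (a i).re ∧ σ ≤ (b i).re) (hab' : ∀ j, σ ≤ (a' j).re ∧ σ ≤ (b' j).re)
    {P : Finset ℕ} (hP : ∀ q ∈ P, q.Prime) :
    ‖∏ q ∈ P, coupledLocalFactorMuW w m M a b a' b' q‖ ≤
      zetaR (1 + σ) ^ (2 * crudeExp (Fintype.card ι) (Fintype.card κ)) := by
  set C := crudeExp (Fintype.card ι) (Fintype.card κ) with hC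
  have hfac : ∀ q ∈ P, ‖coupledLocalFactorMuW w m M a b a' b' q‖ ≤ (1 + (q : ℝ) ^ (-(1 + σ))) ^ (2 * C) := by
    intro q hq
    have h1 := norm_coupledLocalFactorMuW_sub_one_le hw m M hσ.le hab hab' (hP q hq)
    have h2 : ‖coupledLocalFactorMuW w m M a b a' b' q‖ ≤ 1 + ((2 * C : ℕ) : ℝ) * (q : ℝ) ^ (-(1 + σ)) := by
      have := norm_le_norm_add_norm_sub' (coupledLocalFactorMuW w m M a b a' b' q) 1
      rw [norm_one] at this; push_cast; linarith
    refine h2.trans ?_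
    have h0 : 0 ≤ (q : ℝ) ^ (-(1 + σ)) := Real.rpow_nonneg (Nat.cast_nonneg q) _
    exact one_add_mul_le_pow (by linarith) (2 * C)
  calc ‖∏ q ∈ P, coupledLocalFactorMuW w m M a b a' b' q‖ = ∏ q ∈ P, ‖coupledLocalFactorMuW w m M a b a' b' q‖ :=
        norm_prod _ _
    _ ≤ ∏ q ∈ P, (1 + (q : ℝ) ^ (-(1 + σ))) ^ (2 * C) := Finset.prod_le_prod (fun _ _ => norm_nonneg _) hfac
    _ = (∏ q ∈ P, (1 + (q : ℝ) ^ (-(1 + σ)))) ^ (2 * C) := Finset.prod_pow _ _ _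
    _ ≤ zetaR (1 + σ) ^ (2 * C) :=
        pow_le_pow_left₀ (Finset.prod_nonneg fun q _ => by positivity)
          (prod_one_add_le_zetaR (by linarith) hP) (2 * C)

/-- **`∏_p K^w_p ≪ (log x)^{O_k(1)}`**, in the form `‖K^w‖ ≤ ζ(1+σ)^{2(3k₁+3k₂+9k₁k₂)}`.
[cite: Maynard2016LargeGaps, §6 displays (6.11), (6.32)] -/
theorem norm_coupledKernelW_le_zetaR_pow {w : ℕ → ℂ} (hw : IsLcmWeight w) {W : ℕ} (m : ℕ)
    (M : ℕ → Finset (ι × κ)) {a b : ι → ℂ} {a' b' : κ → ℂ} {σ : ℝ} (hσ : 0 < σ)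
    (hab : ∀ i, σ ≤ (a i).re ∧ σ ≤ (b i).re) (hab' : ∀ j, σ ≤ (a' j).re ∧ σ ≤ (b' j).re) :
    ‖coupledKernelW w W m M a b a' b'‖ ≤
      zetaR (1 + σ) ^ (2 * crudeExp (Fintype.card ι) (Fintype.card κ)) := by
  classical
  refine le_of_tendsto' ((continuous_norm.tendsto _).comp
    (tendsto_prod_coupledLocalFactorMuW hw (W := W) (m := m) M hσ hab hab')) fun N => ?_
  exact norm_prod_coupledLocalFactorMuW_le hw m M hσ hab hab' fun q hq => prime_of_mem_primesBelowNotDvd hq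

end LcmEuler

end Literature.NumberTheory.Sieve

end
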